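import Literature.NumberTheory.Rogawski1990.LocalTransferFundamentalLemma
import Literature.MeasureTheory.Group.ConjClassClosedEmbedding
import Literature.MeasureTheory.Group.OrbitalDescentFunction
import Mathlib.Order.Disjointed
import Mathlib.MeasureTheory.Integral.Prod
import HarnessLib

/-!
# Support localisation for orbital integrals at an element with compact centraliser: clopen truncation, finite clopen partition
# subordinate to conjugates of compact open subgroups, `Ad`-transport, and `K`-averaging — all preserving `∫_G f(h t h⁻¹) dν(h)`

Topic `NumberTheory/Automorphic`; namespace `Literature.NumberTheory.Automorphic`.  THEOREMS ONLY (no definition, no instance, no notation, no named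
fact, no `sorry`); generic locally compact group `G`.  Cell `pub/hodgecm-mathlib` (D-0151), crux H413 = `stmt-HodgeConjecture-24833`; road «R1LL-tree»
(LEAD F0P3a-plan (g10) WORD T9-8 (A); architect A-p16 (g27), RULINGS A-1∕A-2∕A-3) = the in-house pay-down of the rank-one unstable transfer
★ `Rogawski1990.RankOneUnstableTransferNonsplitCME` [Rogawski1990 Lemma 4.9.3; LabesseLanglands1979 §2]; THIS FILE = brick I-5b «(U5) SUPPORT
LOCALISATION» of B-p12 (g29)'s design census 86286e4d §1, in GENERIC form (the `U(Φ₂)_v`-specific input «a compact element stabilises a vertex lattice» is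
brick I-5a, A-p03 (g25), and is consumed downstream as the open cover of §3 here).

WHAT IS PROVED (for a topological group `G`, a left-invariant measure `ν` — right-invariant where stated —, an element `t ∈ G`, and
`f : G → ℂ` locally constant with compact support; the «plain orbital integral» is `∫ h, f (h * t * h⁻¹) ∂ν`, which for COMPACT `Z(t)` and the canonical
normalisation IS the orbital integral ★ `IsCanonical.eq_map_mk_of_compactSpace`):
* §1 PROPERNESS: with `Z(t)` compact and the class of `t` closed, `{h | h t h⁻¹ ∈ Q}` is compact for every compact `Q`
  (`isCompact_setOf_conj_mem_of_isClosed`; via ★ `isCompact_preimage_descConj_id_of_isClosed` and `isCompact_preimage_mk_of_isCompact`), hence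
  `h ↦ f (h t h⁻¹)` has compact support (`hasCompactSupport_comp_conj`).
* §2 `Ad`-TRANSPORT: `∫ f (y (h t h⁻¹) y⁻¹) dν(h) = ∫ f (h t h⁻¹) dν(h)` (`integral_comp_conj_conj_eq`, left invariance), and `x ↦ f (y x y⁻¹)` is again
  locally constant with compact support, supported in `y⁻¹ · tsupport f · y`.
* §3 CLOPEN TRUNCATION AND PARTITION: for a clopen `S` containing the class of `t`, `f` and `S.indicator f` have the same plain orbital integral at `t`
  (`integral_indicator_comp_conj_eq`); a compact set covered by clopen sets `U i` admits a FINITE CLOPEN PARTITION subordinate to the cover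
  (`exists_clopen_partition_subordinate`, Mathlib `disjointed` on `Fin n`), whence `f = Σ_k (P k).indicator f` with each summand locally constant,
  compactly supported, `tsupport ⊆ U (i k)` (`exists_sum_indicator_eq_of_cover`).
* §4 `K`-AVERAGING over a compact open subgroup `K` (`ν` two-sided invariant): `f♮ x := (ν.real K)⁻¹ • ∫ k, K.indicator 1 k • f (k x k⁻¹) dν` is locally
  constant (`isLocallyConstant_conjAverage`), compactly supported (`hasCompactSupport_conjAverage`), `Ad K`-invariant (`conjAverage_conj_eq`), keeps right
  invariance under a subgroup normalised by `K` (`conjAverage_mul_right_eq`), is supported in any closed `Ad K`-stable set containing `tsupport f`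
  (`tsupport_conjAverage_subset`), and has THE SAME plain orbital integral at every `t` whose orbit map is proper (`integral_conjAverage_comp_conj_eq`, Fubini).
* §5 (ED. 2) ASSEMBLY `exists_sum_integral_conj_eq_of_clopen_cover`: for a clopen `S` covered by conjugates of compact open subgroups `K i` and `f ∈ C_c^∞(G)`, finitely many
  `φ k ∈ C_c^∞(G)` with `tsupport (φ k) ⊆ K (i k)`, `Ad (K (i k))`-invariant, and `∫ f(h t h⁻¹) dν = Σ_k ∫ φ_k(h t h⁻¹) dν` for every `t` with class `⊆ S` and proper orbit map.
HONEST SCOPE: elementary harmonic analysis on `l`-groups [BernsteinZelevinsky1976 §1; Rogawski1990 §4.9 p. 54 «`Φ(γ, f)` … for `f ∈ C(G)`»]; nothing here is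
specific to unitary groups and nothing here proves the transfer; HC_CM is proved only modulo the printed citations until rung 0 closes.

## References
* [Rogawski1990] J. D. Rogawski, *Automorphic Representations of Unitary Groups in Three Variables*, Ann. of Math. Stud. 123 (1990), §4.9 p. 54 (orbital
  integrals of `C_c^∞` functions), §1.6 p. 6.
* [BernsteinZelevinsky1976] I. N. Bernstein, A. V. Zelevinsky, *Representations of the group GL(n, F) where F is a non-archimedean local field*, Russian
  Math. Surveys 31 (1976), §1.1–§1.3 (`l`-spaces, `S(X)`, finite clopen partitions).
* [DeitmarEchterhoff2014] A. Deitmar, S. Echterhoff, *Principles of Harmonic Analysis*, 2nd ed. (2014), Lemma 9.3.3 (orbit maps at closed classes).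
-/

noncomputable section

open MeasureTheory Measure Topology Set Filter Function
open scoped Pointwise

namespace Literature.NumberTheory.Automorphic

open Literature.MeasureTheory.Group Literature.NumberTheory.Rogawski1990

/-! ## §1 Properness of the orbit map at an element with compact centraliser and closed class -/

section Proper

variable {G : Type*} [Group G] [TopologicalSpace G] [IsTopologicalGroup G]

/-- The quotient map by a COMPACT subgroup is proper: preimages of compact sets are compact (`G` locally compact Hausdorff).
[cite: DeitmarEchterhoff2014, Lemma 9.3.3] -/
theorem isCompact_preimage_mk_of_isCompact [LocallyCompactSpace G] [T2Space G] (C : Subgroup G) (hC : IsCompact (C : Set G))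
    {S : Set (G ⧸ C)} (hS : IsCompact S) : IsCompact ((QuotientGroup.mk : G → G ⧸ C) ⁻¹' S) := by
  haveI : IsClosed (C : Set G) := hC.isClosed
  -- cover `S` by images of interiors of compact neighbourhoods
  have hcov : S ⊆ ⋃ g : G, (QuotientGroup.mk : G → G ⧸ C) '' interior (Classical.choose (exists_compact_mem_nhds g)) := by
    intro s hs
    obtain ⟨g, rfl⟩ := QuotientGroup.mk_surjective s
    refine Set.mem_iUnion.2 ⟨g, ⟨g, ?_, rfl⟩⟩
    exact mem_interior_iff_mem_nhds.2 (Classical.choose_spec (exists_compact_mem_nhds g)).2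
  obtain ⟨I, hI⟩ := hS.elim_finite_subcover _ (fun g => QuotientGroup.isOpenMap_coe _ isOpen_interior) hcov
  set Kt : Set G := ⋃ g ∈ I, Classical.choose (exists_compact_mem_nhds g) with hKt
  have hKtc : IsCompact Kt := I.isCompact_biUnion fun g _ => (Classical.choose_spec (exists_compact_mem_nhds g)).1
  have hsub : (QuotientGroup.mk : G → G ⧸ C) ⁻¹' S ⊆ Kt * (C : Set G) := by
    intro h hh
    obtain ⟨g, hgI, hg⟩ := Set.mem_iUnion₂.1 (hI hh)
    obtain ⟨k, hk, hkh⟩ := hg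
    have hkC : k⁻¹ * h ∈ C := QuotientGroup.eq.1 hkh
    refine Set.mem_mul.2 ⟨k, Set.mem_iUnion₂.2 ⟨g, hgI, interior_subset hk⟩, k⁻¹ * h, hkC, by group⟩
  exact (hKtc.mul hC).of_isClosed_subset (hS.isClosed.preimage QuotientGroup.continuous_mk) hsub

/-- **The orbit map of `t` is proper when `Z(t)` is compact and the class of `t` is closed**: `{h | h t h⁻¹ ∈ Q}` is compact for compact `Q`
(★ `isCompact_preimage_descConj_id_of_isClosed` on `G ⧸ Z(t)`, pulled back along the proper quotient map). [cite: DeitmarEchterhoff2014, Lemma 9.3.3] [cite: Rogawski1990, §4.9 p. 54] -/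
theorem isCompact_setOf_conj_mem_of_isClosed [SigmaCompactSpace G] [LocallyCompactSpace G] [T2Space G] (t : G)
    (hO : IsClosed {g | ∃ y : G, y * t * y⁻¹ = g}) (hZ : IsCompact ((Subgroup.centralizer ({t} : Set G) : Subgroup G) : Set G))
    {Q : Set G} (hQ : IsCompact Q) : IsCompact {h : G | h * t * h⁻¹ ∈ Q} := by
  have hS := isCompact_preimage_descConj_id_of_isClosed t hO hQ
  have heq : {h : G | h * t * h⁻¹ ∈ Q} =
      (QuotientGroup.mk : G → G ⧸ Subgroup.centralizer ({t} : Set G)) ⁻¹'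
        (descConj t (Subgroup.centralizer ({t} : Set G)) (fun _ hg => Subgroup.mem_centralizer_singleton_iff.1 hg) id ⁻¹' Q) := by
    ext h; simp only [Set.mem_setOf_eq, Set.mem_preimage, descConj_mk, id]
  rw [heq]
  exact isCompact_preimage_mk_of_isCompact _ hZ hS

/-- `h ↦ f (h t h⁻¹)` has compact support when `f` does and the orbit map of `t` is proper. [cite: Rogawski1990, §4.9 p. 54] -/
theorem hasCompactSupport_comp_conj {α : Type*} [TopologicalSpace α] [Zero α] (t : G) {f : G → α} (hf : HasCompactSupport f)
    (hprop : ∀ Q : Set G, IsCompact Q → IsCompact {h : G | h * t * h⁻¹ ∈ Q}) :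
    HasCompactSupport fun h : G => f (h * t * h⁻¹) := by
  refine HasCompactSupport.of_support_subset_isCompact (hprop _ hf) fun h hh => ?_
  exact subset_tsupport _ (Function.mem_support.2 (Function.mem_support.1 hh))

end Proper

/-! ## §2 `Ad`-transport -/

section Transport

variable {G : Type*} [Group G] [TopologicalSpace G] [IsTopologicalGroup G] [MeasurableSpace G] [BorelSpace G]
  (ν : Measure G) [ν.IsMulLeftInvariant]

omit [TopologicalSpace G] [IsTopologicalGroup G] [BorelSpace G] in
/-- **Conjugating the test function does not change the plain orbital integral**: `∫ f(y (h t h⁻¹) y⁻¹) dν(h) = ∫ f(h t h⁻¹) dν(h)` (`y (h t h⁻¹) y⁻¹ = (yh) t (yh)⁻¹`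
and `ν` is left invariant). [cite: Rogawski1990, §4.9 p. 54] -/
theorem integral_comp_conj_conj_eq [MeasurableMul G] (t y : G) (f : G → ℂ) :
    ∫ h, f (y * (h * t * h⁻¹) * y⁻¹) ∂ν = ∫ h, f (h * t * h⁻¹) ∂ν := by
  have h1 : ∀ h : G, y * (h * t * h⁻¹) * y⁻¹ = (y * h) * t * (y * h)⁻¹ := fun h => by group
  simp_rw [h1]
  exact integral_mul_left_eq_self (fun h => f (h * t * h⁻¹)) y

omit [MeasurableSpace G] [BorelSpace G] in
/-- `x ↦ f (y x y⁻¹)` is locally constant with compact support if `f` is. [cite: BernsteinZelevinsky1976, §1.1] -/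
theorem isLocSmooth_comp_conj {f : G → ℂ} (hf : IsLocSmooth f) (y : G) : IsLocSmooth fun x => f (y * x * y⁻¹) :=
  ⟨hf.1.comp_continuous ((continuous_const.mul continuous_id).mul continuous_const),
    hf.2.comp_homeomorph ((Homeomorph.mulLeft y).trans (Homeomorph.mulRight y⁻¹))⟩

omit [MeasurableSpace G] [BorelSpace G] in
/-- Support of the conjugated function: `tsupport (x ↦ f (y x y⁻¹)) ⊆ {x | y x y⁻¹ ∈ T}` for every CLOSED `T ⊇ tsupport f` (e.g. `T` a conjugate of a compact
open subgroup). [cite: BernsteinZelevinsky1976, §1.1] -/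
theorem tsupport_comp_conj_subset {α : Type*} [TopologicalSpace α] [Zero α] {f : G → α} (y : G) {T : Set G} (hT : IsClosed T)
    (hfT : tsupport f ⊆ T) : tsupport (fun x => f (y * x * y⁻¹)) ⊆ {x | y * x * y⁻¹ ∈ T} := by
  refine closure_minimal (fun x hx => ?_) (hT.preimage ((continuous_const.mul continuous_id).mul continuous_const))
  exact hfT (subset_tsupport _ (Function.mem_support.2 (Function.mem_support.1 hx)))

end Transport

/-! ## §3 Clopen truncation and finite clopen partitions subordinate to a cover -/

section Clopen

variable {G : Type*} [Group G] [TopologicalSpace G] [IsTopologicalGroup G] [MeasurableSpace G]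

omit [Group G] [IsTopologicalGroup G] [MeasurableSpace G] in
/-- Truncating `f` to a clopen set keeps it locally constant with compact support. [cite: BernsteinZelevinsky1976, §1.1] -/
theorem isLocSmooth_indicator_of_isClopen {f : G → ℂ} (hf : IsLocSmooth f) {S : Set G} (hS : IsClopen S) : IsLocSmooth (S.indicator f) := by
  refine ⟨(IsLocallyConstant.iff_eventually_eq _).2 fun x => ?_, hf.2.mono fun x hx => ?_⟩
  · by_cases hx : x ∈ S
    · filter_upwards [hS.isOpen.mem_nhds hx, hf.1.eventually_eq x] with y hy hfy
      rw [Set.indicator_of_mem hy, Set.indicator_of_mem hx, hfy]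
    · filter_upwards [hS.compl.isOpen.mem_nhds hx] with y hy
      rw [Set.indicator_of_notMem (Set.notMem_of_mem_compl hy), Set.indicator_of_notMem hx]
  · exact Function.mem_support.2 fun h0 => Function.mem_support.1 hx (Set.indicator_apply_eq_zero.2 fun _ => h0)

omit [TopologicalSpace G] [IsTopologicalGroup G] in
/-- **Clopen truncation**: if every conjugate `h t h⁻¹` lies in `S`, then `f` and `S.indicator f` have the same plain orbital integral at `t` (the integrands
agree pointwise). [cite: Rogawski1990, §4.9 p. 54] -/
theorem integral_indicator_comp_conj_eq (ν : Measure G) (t : G) {S : Set G} (hS : ∀ h : G, h * t * h⁻¹ ∈ S) (f : G → ℂ) :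
    ∫ h, S.indicator f (h * t * h⁻¹) ∂ν = ∫ h, f (h * t * h⁻¹) ∂ν := by
  refine integral_congr_ae (Eventually.of_forall fun h => ?_)
  simp only [Set.indicator_of_mem (hS h)]

omit [Group G] [IsTopologicalGroup G] [MeasurableSpace G] in
/-- **Finite clopen partition subordinate to a clopen cover of a compact set**: if the compact `Q` is covered by clopen sets `U i`, there are finitely many
indices `i k` and pairwise disjoint CLOPEN sets `P k ⊆ U (i k)` still covering `Q` (`disjointed` of a finite subcover). [cite: BernsteinZelevinsky1976, §1.3] -/
theorem exists_clopen_partition_subordinate {ι : Type*} (U : ι → Set G) (hU : ∀ i, IsClopen (U i)) {Q : Set G} (hQ : IsCompact Q)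
    (hcov : Q ⊆ ⋃ i, U i) :
    ∃ (n : ℕ) (i : Fin n → ι) (P : Fin n → Set G), (∀ k, IsClopen (P k)) ∧ (∀ k, P k ⊆ U (i k)) ∧
      Pairwise (Disjoint on P) ∧ Q ⊆ ⋃ k, P k := by
  obtain ⟨s, hs⟩ := hQ.elim_finite_subcover U (fun i => (hU i).isOpen) hcov
  -- enumerate the finite subcover
  set n := s.card
  obtain ⟨e⟩ : Nonempty (Fin n ≃ ↥s) := ⟨(Finset.equivFin s).symm⟩
  let i : Fin n → ι := fun k => (e k : ι)
  let V : Fin n → Set G := fun k => U (i k)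
  refine ⟨n, i, disjointed V, fun k => ?_, fun k => disjointed_le V k, disjoint_disjointed V, ?_⟩
  · -- `disjointed V k = V k \ (Finset.Iio k).sup V` is clopen
    rw [disjointed_apply]
    refine (hU (i k)).diff ?_
    have : ((Finset.Iio k).sup V : Set G) = ⋃ j ∈ Finset.Iio k, V j := by
      ext x; simp only [Finset.sup_set_eq_biUnion, Set.mem_iUnion]
    rw [this]
    exact isClopen_biUnion_finset fun j _ => hU (i j)
  · intro x hx
    obtain ⟨j, hjs, hxj⟩ := Set.mem_iUnion₂.1 (hs hx)
    have hxV : x ∈ ⋃ k, V k := Set.mem_iUnion.2 ⟨e.symm ⟨j, hjs⟩, by simp [V, i]; exact hxj⟩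
    rwa [← iUnion_disjointed] at hxV

omit [Group G] [IsTopologicalGroup G] [MeasurableSpace G] in
/-- **Decomposition of a test function along a clopen cover of its support**: if `tsupport f` is covered by clopen sets `U i`, then
`f = Σ_k (P k).indicator f` for a finite clopen partition `P` subordinate to the cover; each summand is locally constant with compact support and
`tsupport ((P k).indicator f) ⊆ U (i k)`. [cite: BernsteinZelevinsky1976, §1.3] -/
theorem exists_sum_indicator_eq_of_cover {ι : Type*} (U : ι → Set G) (hU : ∀ i, IsClopen (U i)) {f : G → ℂ} (hf : IsLocSmooth f)
    (hcov : tsupport f ⊆ ⋃ i, U i) :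
    ∃ (n : ℕ) (i : Fin n → ι) (P : Fin n → Set G), (∀ k, IsClopen (P k)) ∧ (∀ k, IsLocSmooth ((P k).indicator f)) ∧
      (∀ k, tsupport ((P k).indicator f) ⊆ U (i k)) ∧ (f = fun x => ∑ k, (P k).indicator f x) := by
  obtain ⟨n, i, P, hP, hPU, hdisj, hQ⟩ := exists_clopen_partition_subordinate U hU hf.2 hcov
  refine ⟨n, i, P, hP, fun k => isLocSmooth_indicator_of_isClopen hf (hP k), fun k => ?_, ?_⟩
  · -- `tsupport (1_P f) ⊆ closure (P k) = P k ⊆ U (i k)`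
    refine (closure_mono (Set.support_indicator_subset)).trans ?_ |>.trans (hPU k)
    rw [(hP k).isClosed.closure_eq]
  · funext x
    by_cases hx : x ∈ tsupport f
    · -- exactly one piece contains `x`
      obtain ⟨k₀, hk₀⟩ := Set.mem_iUnion.1 (hQ hx)
      rw [Finset.sum_eq_single k₀]
      · rw [Set.indicator_of_mem hk₀]
      · intro k _ hk
        exact Set.indicator_of_notMem (fun hxk => (hdisj hk).le_bot ⟨hxk, hk₀⟩) _
      · intro h; exact absurd (Finset.mem_univ k₀) h
    · have hfx : f x = 0 := image_eq_zero_of_notMem_tsupport hx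
      rw [hfx, eq_comm]
      exact Finset.sum_eq_zero fun k _ => Set.indicator_apply_eq_zero.2 fun _ => hfx

end Clopen

/-! ## §4 `K`-averaging over a compact open subgroup -/

section Average

variable {G : Type*} [Group G] [TopologicalSpace G] [IsTopologicalGroup G] [MeasurableSpace G] [BorelSpace G]
  (ν : Measure G) (K : Subgroup G)

/- Throughout, the `K`-AVERAGE of `f` is written out (no definition):
`f♮ x := ((ν.real ↑K : ℂ))⁻¹ * ∫ k, (↑K).indicator 1 k * f (k * x * k⁻¹) ∂ν`. -/

omit [BorelSpace G] in
/-- **The `K`-average of a locally constant `f` is locally constant** (`K` compact; tube lemma ★ `exists_nhds_forall_conj_eq_of_isLocallyConstant`).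
[cite: BernsteinZelevinsky1976, §1.1] -/
theorem isLocallyConstant_conjAverage (hKc : IsCompact (K : Set G)) {f : G → ℂ} (hf : IsLocallyConstant f) :
    IsLocallyConstant fun x => ((ν.real (K : Set G) : ℂ))⁻¹ *
      ∫ k, (K : Set G).indicator (fun _ => (1 : ℂ)) k * f (k * x * k⁻¹) ∂ν := by
  refine (IsLocallyConstant.iff_eventually_eq _).2 fun x => ?_
  obtain ⟨U, hU, hUK⟩ := exists_nhds_forall_conj_eq_of_isLocallyConstant hf hKc x
  filter_upwards [hU] with y hy
  congr 1
  refine integral_congr_ae (Eventually.of_forall fun k => ?_)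
  by_cases hk : k ∈ (K : Set G)
  · simp only [hUK k hk y hy]
  · simp only [Set.indicator_of_notMem hk, zero_mul]

omit [TopologicalSpace G] [IsTopologicalGroup G] [BorelSpace G] in
/-- Support of the `K`-average: if `f♮ x ≠ 0` then `f (k x k⁻¹) ≠ 0` for some `k ∈ K`. [cite: BernsteinZelevinsky1976, §1.1] -/
theorem exists_mem_apply_conj_ne_zero_of_conjAverage_ne_zero {f : G → ℂ} {x : G}
    (hx : ((ν.real (K : Set G) : ℂ))⁻¹ * ∫ k, (K : Set G).indicator (fun _ => (1 : ℂ)) k * f (k * x * k⁻¹) ∂ν ≠ 0) :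
    ∃ k ∈ K, f (k * x * k⁻¹) ≠ 0 := by
  by_contra h
  push Not at h
  apply hx
  have : (fun k => (K : Set G).indicator (fun _ => (1 : ℂ)) k * f (k * x * k⁻¹)) = fun _ => 0 := by
    funext k
    by_cases hk : k ∈ (K : Set G)
    · rw [h k hk, mul_zero]
    · rw [Set.indicator_of_notMem hk, zero_mul]
  rw [this, integral_zero, mul_zero]

omit [BorelSpace G] in
/-- **The `K`-average of a compactly supported `f` is compactly supported**: its support lies in `Ad(K⁻¹)(tsupport f)`, the continuous image of the
compact `K × tsupport f`. [cite: BernsteinZelevinsky1976, §1.1] -/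
theorem hasCompactSupport_conjAverage (hKc : IsCompact (K : Set G)) {f : G → ℂ} (hf : HasCompactSupport f) :
    HasCompactSupport fun x => ((ν.real (K : Set G) : ℂ))⁻¹ *
      ∫ k, (K : Set G).indicator (fun _ => (1 : ℂ)) k * f (k * x * k⁻¹) ∂ν := by
  refine HasCompactSupport.of_support_subset_isCompact
    ((hKc.prod hf).image ((continuous_fst.inv.mul continuous_snd).mul continuous_fst)) fun x hx => ?_
  obtain ⟨k, hk, hfk⟩ := exists_mem_apply_conj_ne_zero_of_conjAverage_ne_zero ν K (Function.mem_support.1 hx)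
  refine ⟨(k, k * x * k⁻¹), Set.mk_mem_prod hk (subset_tsupport _ (Function.mem_support.2 hfk)), ?_⟩
  show k⁻¹ * (k * x * k⁻¹) * k = x
  group

omit [IsTopologicalGroup G] [BorelSpace G] in
/-- The `K`-average is supported in every CLOSED `Ad(K)`-stable set containing `tsupport f` (e.g. `K′` itself when `tsupport f ⊆ K′` and `K ≤ K′`).
[cite: BernsteinZelevinsky1976, §1.1] -/
theorem tsupport_conjAverage_subset {f : G → ℂ} {T : Set G} (hT : IsClosed T) (hfT : tsupport f ⊆ T)
    (hTK : ∀ k ∈ K, ∀ x, k * x * k⁻¹ ∈ T → x ∈ T) :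
    tsupport (fun x => ((ν.real (K : Set G) : ℂ))⁻¹ *
      ∫ k, (K : Set G).indicator (fun _ => (1 : ℂ)) k * f (k * x * k⁻¹) ∂ν) ⊆ T := by
  refine closure_minimal (fun x hx => ?_) hT
  obtain ⟨k, hk, hfk⟩ := exists_mem_apply_conj_ne_zero_of_conjAverage_ne_zero ν K (Function.mem_support.1 hx)
  exact hTK k hk x (hfT (subset_tsupport _ (Function.mem_support.2 hfk)))

omit [TopologicalSpace G] [IsTopologicalGroup G] [BorelSpace G] in
/-- **The `K`-average is `Ad(K)`-invariant** (`ν` right invariant: substitute `k ↦ k k₀`). [cite: BernsteinZelevinsky1976, §1.1] -/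
theorem conjAverage_conj_eq [MeasurableMul G] [ν.IsMulRightInvariant] (f : G → ℂ) {k₀ : G} (hk₀ : k₀ ∈ K) (x : G) :
    ((ν.real (K : Set G) : ℂ))⁻¹ * ∫ k, (K : Set G).indicator (fun _ => (1 : ℂ)) k * f (k * (k₀ * x * k₀⁻¹) * k⁻¹) ∂ν =
      ((ν.real (K : Set G) : ℂ))⁻¹ * ∫ k, (K : Set G).indicator (fun _ => (1 : ℂ)) k * f (k * x * k⁻¹) ∂ν := by
  congr 1
  have hind : ∀ k : G, (K : Set G).indicator (fun _ => (1 : ℂ)) (k * k₀) = (K : Set G).indicator (fun _ => (1 : ℂ)) k := by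
    intro k
    by_cases hk : k ∈ (K : Set G)
    · rw [Set.indicator_of_mem hk, Set.indicator_of_mem (K.mul_mem hk hk₀)]
    · have hk' : k * k₀ ∉ (K : Set G) := fun h => hk (by simpa using K.mul_mem h (K.inv_mem hk₀))
      rw [Set.indicator_of_notMem hk, Set.indicator_of_notMem hk']
  have h1 : ∀ k : G, k * (k₀ * x * k₀⁻¹) * k⁻¹ = (k * k₀) * x * (k * k₀)⁻¹ := fun k => by group
  calc ∫ k, (K : Set G).indicator (fun _ => (1 : ℂ)) k * f (k * (k₀ * x * k₀⁻¹) * k⁻¹) ∂ν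
      = ∫ k, (K : Set G).indicator (fun _ => (1 : ℂ)) (k * k₀) * f ((k * k₀) * x * (k * k₀)⁻¹) ∂ν := by
        refine integral_congr_ae (Eventually.of_forall fun k => ?_); simp only [hind k, h1 k]
    _ = ∫ k, (K : Set G).indicator (fun _ => (1 : ℂ)) k * f (k * x * k⁻¹) ∂ν :=
        integral_mul_right_eq_self (fun k => (K : Set G).indicator (fun _ => (1 : ℂ)) k * f (k * x * k⁻¹)) k₀

omit [TopologicalSpace G] [IsTopologicalGroup G] [BorelSpace G] in
/-- **The `K`-average keeps right invariance under a subgroup normalised by `K`**: if `f (x u) = f x` for `u ∈ K_m` and `K` normalises `K_m`, then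
`f♮ (x u) = f♮ x` (so `f♮|_K` factors through `K ⧸ K_m` when `f` has level `K_m ⊴ K`). [cite: BernsteinZelevinsky1976, §1.1] -/
theorem conjAverage_mul_right_eq (Km : Subgroup G) (hKm : ∀ k ∈ K, ∀ u ∈ Km, k * u * k⁻¹ ∈ Km) {f : G → ℂ}
    (hfR : ∀ x, ∀ u ∈ Km, f (x * u) = f x) (x : G) {u : G} (hu : u ∈ Km) :
    ((ν.real (K : Set G) : ℂ))⁻¹ * ∫ k, (K : Set G).indicator (fun _ => (1 : ℂ)) k * f (k * (x * u) * k⁻¹) ∂ν =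
      ((ν.real (K : Set G) : ℂ))⁻¹ * ∫ k, (K : Set G).indicator (fun _ => (1 : ℂ)) k * f (k * x * k⁻¹) ∂ν := by
  congr 1
  refine integral_congr_ae (Eventually.of_forall fun k => ?_)
  by_cases hk : k ∈ (K : Set G)
  · have : k * (x * u) * k⁻¹ = (k * x * k⁻¹) * (k * u * k⁻¹) := by group
    simp only [this, hfR _ _ (hKm k hk u hu)]
  · simp only [Set.indicator_of_notMem hk, zero_mul]

/-- **The `K`-average has the same plain orbital integral**: `∫ f♮(h t h⁻¹) dν(h) = ∫ f(h t h⁻¹) dν(h)` for `ν` a two-sided Haar measure, `K` compact open and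
`t` with PROPER orbit map (Fubini over the compact `K × {h | h t h⁻¹ ∈ Ad(K)(tsupport f)}`, then §2 for each `k`). [cite: Rogawski1990, §4.9 p. 54] [cite: BernsteinZelevinsky1976, §1.1] -/
theorem integral_conjAverage_comp_conj_eq [SecondCountableTopology G] [LocallyCompactSpace G] [T2Space G]
    [ν.IsHaarMeasure] [ν.IsMulRightInvariant]
    (hKo : IsOpen (K : Set G)) (hKc : IsCompact (K : Set G)) {f : G → ℂ} (hf : IsLocSmooth f) (t : G)
    (hprop : ∀ Q : Set G, IsCompact Q → IsCompact {h : G | h * t * h⁻¹ ∈ Q}) :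
    ∫ h, ((ν.real (K : Set G) : ℂ))⁻¹ * ∫ k, (K : Set G).indicator (fun _ => (1 : ℂ)) k * f (k * (h * t * h⁻¹) * k⁻¹) ∂ν ∂ν =
      ∫ h, f (h * t * h⁻¹) ∂ν := by
  have hKcl : IsClosed (K : Set G) := K.isClosed_of_isOpen hKo
  have hKpos : (ν.real (K : Set G) : ℂ) ≠ 0 := by
    have : 0 < ν.real (K : Set G) :=
      ENNReal.toReal_pos (hKo.measure_pos ν ⟨1, K.one_mem⟩).ne' hKc.measure_lt_top.ne
    exact_mod_cast this.ne'
  -- the integrand on `G × G` and its compact support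
  set F : G → G → ℂ := fun h k => (K : Set G).indicator (fun _ => (1 : ℂ)) k * f (k * (h * t * h⁻¹) * k⁻¹) with hF
  -- `T := Ad(K)(tsupport f)` is compact, `S := {h | h t h⁻¹ ∈ T}` is compact
  set T : Set G := (fun p : G × G => p.1⁻¹ * p.2 * p.1) '' ((K : Set G) ×ˢ tsupport f) with hT
  have hTc : IsCompact T := (hKc.prod hf.2).image ((continuous_fst.inv.mul continuous_snd).mul continuous_fst)
  have hSc : IsCompact {h : G | h * t * h⁻¹ ∈ T} := hprop T hTc
  have hsupp : ∀ h k, F h k ≠ 0 → (h, k) ∈ {h : G | h * t * h⁻¹ ∈ T} ×ˢ (K : Set G) := by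
    intro h k hne
    have hk : k ∈ (K : Set G) := by
      by_contra hk; exact hne (by simp only [hF, Set.indicator_of_notMem hk, zero_mul])
    have hfk : f (k * (h * t * h⁻¹) * k⁻¹) ≠ 0 := by
      intro h0; exact hne (by simp only [hF, h0, mul_zero])
    refine Set.mk_mem_prod ?_ hk
    refine ⟨(k, k * (h * t * h⁻¹) * k⁻¹), Set.mk_mem_prod hk (subset_tsupport _ (Function.mem_support.2 hfk)), ?_⟩
    show k⁻¹ * (k * (h * t * h⁻¹) * k⁻¹) * k = h * t * h⁻¹
    group
  -- continuity of the un-truncated integrand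
  have hcont : Continuous fun p : G × G => f (p.2 * (p.1 * t * p.1⁻¹) * p.2⁻¹) :=
    hf.continuous.comp ((continuous_snd.mul ((continuous_fst.mul continuous_const).mul continuous_fst.inv)).mul continuous_snd.inv)
  -- integrability of `uncurry F` on `ν.prod ν`
  have hint : Integrable (uncurry F) (ν.prod ν) := by
    have heq : uncurry F = ({h : G | h * t * h⁻¹ ∈ T} ×ˢ (K : Set G)).indicator
        (fun p : G × G => f (p.2 * (p.1 * t * p.1⁻¹) * p.2⁻¹)) := by
      funext p
      by_cases hp : p ∈ {h : G | h * t * h⁻¹ ∈ T} ×ˢ (K : Set G)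
      · rw [Set.indicator_of_mem hp]
        simp only [uncurry, hF, Set.indicator_of_mem (Set.mem_prod.1 hp).2, one_mul]
      · rw [Set.indicator_of_notMem hp]
        by_contra hne
        exact hp (hsupp p.1 p.2 hne)
    rw [heq, integrable_indicator_iff ((hSc.isClosed.prod hKcl).measurableSet)]
    exact hcont.continuousOn.integrableOn_compact (hSc.prod hKc)
  -- swap the integrals
  calc ∫ h, ((ν.real (K : Set G) : ℂ))⁻¹ * ∫ k, F h k ∂ν ∂ν
      = ((ν.real (K : Set G) : ℂ))⁻¹ * ∫ h, ∫ k, F h k ∂ν ∂ν := integral_const_mul _ _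
    _ = ((ν.real (K : Set G) : ℂ))⁻¹ * ∫ k, ∫ h, F h k ∂ν ∂ν := by rw [integral_integral_swap hint]
    _ = ((ν.real (K : Set G) : ℂ))⁻¹ * ∫ k, (K : Set G).indicator (fun _ => (1 : ℂ)) k * ∫ h, f (h * t * h⁻¹) ∂ν ∂ν := by
        congr 1
        refine integral_congr_ae (Eventually.of_forall fun k => ?_)
        simp only [hF]
        rw [integral_const_mul, integral_comp_conj_conj_eq ν t k f]
    _ = ((ν.real (K : Set G) : ℂ))⁻¹ * ((∫ k, (K : Set G).indicator (fun _ => (1 : ℂ)) k ∂ν) * ∫ h, f (h * t * h⁻¹) ∂ν) := by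
        rw [integral_mul_const]
    _ = ∫ h, f (h * t * h⁻¹) ∂ν := by
        rw [integral_indicator_const (1 : ℂ) hKcl.measurableSet, Complex.real_smul, mul_one]
        rw [← mul_assoc, inv_mul_cancel₀ hKpos, one_mul]

end Average

/-! ## §5 Assembly (ED. 2): localise to a clopen set, cut along conjugates of compact open subgroups, transport, average -/

section Assembly

variable {G : Type*} [Group G] [TopologicalSpace G] [IsTopologicalGroup G] [MeasurableSpace G] [BorelSpace G]
  [SecondCountableTopology G] [LocallyCompactSpace G] [T2Space G]
  (ν : Measure G) [ν.IsHaarMeasure] [ν.IsMulRightInvariant]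

omit [MeasurableSpace G] [BorelSpace G] [SecondCountableTopology G] [LocallyCompactSpace G] [T2Space G] in
/-- A conjugate `y K y⁻¹` of an open-and-closed subgroup is clopen. [cite: BernsteinZelevinsky1976, §1.1] -/
theorem isClopen_image_conj (K : Subgroup G) (hKo : IsOpen (K : Set G)) (y : G) :
    IsClopen ((fun x : G => y * x * y⁻¹) '' (K : Set G)) := by
  have he : (fun x : G => y * x * y⁻¹) '' (K : Set G) = (Homeomorph.mulRight y⁻¹).trans (Homeomorph.mulLeft y) '' (K : Set G) := by
    ext x; simp [Homeomorph.mulLeft, Homeomorph.mulRight, mul_assoc]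
  rw [he]
  set e := (Homeomorph.mulRight y⁻¹).trans (Homeomorph.mulLeft y)
  exact ⟨(e.isClosedMap _ (K.isClosed_of_isOpen hKo)), e.isOpenMap _ hKo⟩

omit [TopologicalSpace G] [MeasurableSpace G] [BorelSpace G] [SecondCountableTopology G] [LocallyCompactSpace G] [T2Space G] [IsTopologicalGroup G] in
/-- `y x y⁻¹ ∈ y K y⁻¹ ↔ x ∈ K`. [cite: BernsteinZelevinsky1976, §1.1] -/
theorem conj_mem_image_conj_iff (K : Subgroup G) (y x : G) :
    y * x * y⁻¹ ∈ (fun x : G => y * x * y⁻¹) '' (K : Set G) ↔ x ∈ (K : Set G) := by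
  constructor
  · rintro ⟨k, hk, hkx⟩
    have : k = x := by simpa [mul_assoc] using hkx
    exact this ▸ hk
  · exact fun hx => ⟨x, hx, rfl⟩

/-- **SUPPORT LOCALISATION, ASSEMBLED (generic `G`).**  Let `S ⊆ G` be clopen and covered by the conjugates of finitely or infinitely many compact open subgroups
`K i`.  For every `f ∈ C_c^∞(G)` there are finitely many indices `i k` and functions `φ k ∈ C_c^∞(G)` with `tsupport (φ k) ⊆ K (i k)`, each `φ k` INVARIANT under
`Ad (K (i k))`, such that for EVERY `t` whose conjugacy class lies in `S` and whose orbit map is proper, `∫ f(h t h⁻¹) dν = Σ_k ∫ φ_k(h t h⁻¹) dν` (`ν` a two-sided Haar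
measure).  (`φ k` = the `K (i k)`-average of the `Ad`-transport of the `k`-th clopen piece of `𝟙_S·f`; §3 + §2 + §4.)  This is interface (I1′) of the road «R1LL-tree»
(at `G = H_v`, `S = {tr ∈ 𝒪_w}`, `K i` = the two vertex stabilisers, cover = brick I-5a). [cite: Rogawski1990, §4.9 p. 54] [cite: BernsteinZelevinsky1976, §1.3] -/
theorem exists_sum_integral_conj_eq_of_clopen_cover {ι : Type*} (K : ι → Subgroup G) (hKo : ∀ i, IsOpen (K i : Set G))
    (hKc : ∀ i, IsCompact (K i : Set G)) {S : Set G} (hS : IsClopen S)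
    (hcov : S ⊆ ⋃ i, ⋃ y : G, (fun x : G => y * x * y⁻¹) '' (K i : Set G)) {f : G → ℂ} (hf : IsLocSmooth f) :
    ∃ (n : ℕ) (i : Fin n → ι) (φ : Fin n → G → ℂ),
      (∀ k, IsLocSmooth (φ k)) ∧ (∀ k, tsupport (φ k) ⊆ (K (i k) : Set G)) ∧
      (∀ k, ∀ u ∈ K (i k), ∀ x, φ k (u * x * u⁻¹) = φ k x) ∧
      ∀ t : G, (∀ h : G, h * t * h⁻¹ ∈ S) → (∀ Q : Set G, IsCompact Q → IsCompact {h : G | h * t * h⁻¹ ∈ Q}) →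
        ∫ h, f (h * t * h⁻¹) ∂ν = ∑ k, ∫ h, φ k (h * t * h⁻¹) ∂ν := by
  -- (1) truncate to `S` and cut along the clopen cover `U (i, y) = y (K i) y⁻¹`
  have hf₁ : IsLocSmooth (S.indicator f) := isLocSmooth_indicator_of_isClopen hf hS
  let U : ι × G → Set G := fun p => (fun x : G => p.2 * x * p.2⁻¹) '' (K p.1 : Set G)
  have hU : ∀ p, IsClopen (U p) := fun p => isClopen_image_conj (K p.1) (hKo p.1) p.2
  have hcov₁ : tsupport (S.indicator f) ⊆ ⋃ p, U p := by
    refine ((closure_mono (Set.support_indicator_subset)).trans (by rw [hS.isClosed.closure_eq])).trans fun x hx => ?_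
    obtain ⟨i, hi⟩ := Set.mem_iUnion.1 (hcov hx)
    obtain ⟨y, hy⟩ := Set.mem_iUnion.1 hi
    exact Set.mem_iUnion.2 ⟨(i, y), hy⟩
  obtain ⟨n, j, P, hP, hPsm, hPU, hsum⟩ := exists_sum_indicator_eq_of_cover U hU hf₁ hcov₁
  -- (2) transport the `k`-th piece by `Ad (j k).2` and (3) average over `K (j k).1`
  let g : Fin n → G → ℂ := fun k => (P k).indicator (S.indicator f)
  let ψ : Fin n → G → ℂ := fun k x => g k ((j k).2 * x * (j k).2⁻¹)
  have hψ : ∀ k, IsLocSmooth (ψ k) := fun k => isLocSmooth_comp_conj (hPsm k) (j k).2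
  have hψK : ∀ k, tsupport (ψ k) ⊆ (K (j k).1 : Set G) := by
    intro k
    refine (tsupport_comp_conj_subset (j k).2 (hU (j k)).isClosed (hPU k)).trans fun x hx => ?_
    exact (conj_mem_image_conj_iff (K (j k).1) (j k).2 x).1 hx
  let φ : Fin n → G → ℂ := fun k x => ((ν.real (K (j k).1 : Set G) : ℂ))⁻¹ *
    ∫ u, (K (j k).1 : Set G).indicator (fun _ => (1 : ℂ)) u * ψ k (u * x * u⁻¹) ∂ν
  refine ⟨n, fun k => (j k).1, φ, fun k => ?_, fun k => ?_, fun k u hu x => ?_, fun t htS hprop => ?_⟩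
  · exact ⟨isLocallyConstant_conjAverage ν (K (j k).1) (hKc _) (hψ k).1, hasCompactSupport_conjAverage ν (K (j k).1) (hKc _) (hψ k).2⟩
  · exact tsupport_conjAverage_subset ν (K (j k).1) ((K (j k).1).isClosed_of_isOpen (hKo _)) (hψK k)
      (fun u hu x hx => by
        have h := (K (j k).1).mul_mem ((K (j k).1).mul_mem ((K (j k).1).inv_mem hu) hx) hu
        rwa [show u⁻¹ * (u * x * u⁻¹) * u = x by group] at h)
  · exact conjAverage_conj_eq ν (K (j k).1) (ψ k) hu x
  · -- (4) the integral identity at `t`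
    have hint : ∀ k, Integrable (fun h : G => g k (h * t * h⁻¹)) ν := fun k =>
      ((hPsm k).continuous.comp ((continuous_id.mul continuous_const).mul continuous_id.inv)).integrable_of_hasCompactSupport
        (hasCompactSupport_comp_conj t (hPsm k).2 hprop)
    calc ∫ h, f (h * t * h⁻¹) ∂ν
        = ∫ h, S.indicator f (h * t * h⁻¹) ∂ν := (integral_indicator_comp_conj_eq ν t htS f).symm
      _ = ∫ h, ∑ k, g k (h * t * h⁻¹) ∂ν := by
          refine integral_congr_ae (Eventually.of_forall fun h => ?_)
          exact congrFun hsum (h * t * h⁻¹)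
      _ = ∑ k, ∫ h, g k (h * t * h⁻¹) ∂ν := integral_finsetSum _ fun k _ => hint k
      _ = ∑ k, ∫ h, ψ k (h * t * h⁻¹) ∂ν := by
          refine Finset.sum_congr rfl fun k _ => ?_
          exact (integral_comp_conj_conj_eq ν t (j k).2 (g k)).symm
      _ = ∑ k, ∫ h, φ k (h * t * h⁻¹) ∂ν := by
          refine Finset.sum_congr rfl fun k _ => ?_
          exact (integral_conjAverage_comp_conj_eq ν (K (j k).1) (hKo _) (hKc _) (hψ k) t hprop).symm

end Assembly

end Literature.NumberTheory.Automorphic
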